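import Summits.Schanuel.Schanuel.Theorems.RootDecomp1KDarkLogSq04

/-!
# RootDecomp1KDarkLogSq — lens 6, generation 19 «DARK LOG-SQUARE KERNEL ⇒ THE POSITIVE-ORDER LAYER F₊ OF 33364 IS CLOSED AT n = 2» (K-R27 (F₊) lane; input NW96 Thm 1 BY NAME) — continuation (RootDecomp1KDarkLogSq05): §6 scope certificates + the NAMED MEMBERS `zA` (ratio ℓ_T) and `zB` (ratio towerNumber 4) at the dark scale `tΩ`

(lens-6 g19 `DarkLogSq.lean` [HOME/decomp-schanuel-lens-6/g19/ sha256 81ff816b…, 1170 l; NODE L1934 / REQUEST L1935; critic VERDICT L1938 (K-R27 (F₊) cell credit, port GO)]; port by census-1 gen 17 as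
`RootDecomp1KDarkLogSq01`–`06` — see the PORT NOTE of part 01; `--supports stmt-Schanuel-33364`; rung 0.)
-/

noncomputable section

open Complex IntermediateField Filter Polynomial
open Literature.NumberTheory.Transcendental (NesterenkoWaldschmidt1996_thm_1)
open Summit.Schanuel.Schanuel.Theorems.RootDecomp1KHyper
open Summit.Schanuel.Schanuel.Theorems.RootDecomp1KHyper.HyperCell
open Summit.Schanuel.Schanuel.Theorems.RootDecomp1KGeneric (LiouvilleOrder LogSqLiouville sb_two_of_ordRatio
  sb_two_of_lowOrderResidual)
open Summit.Schanuel.Schanuel.Theorems.RootDecomp1KRelLiouvilleCell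

namespace Summit.Schanuel.Schanuel.Theorems.RootDecomp1KDarkLogSq

/-! ## §6. Scope certificates: the positive-order layer, and two NAMED MEMBERS at a dark scale -/

open Literature.Barriers.Schanuel (TechnicalHypothesis) in
/-- A pair `(t, ρt)` whose ratio has exponential order `2` VIOLATES (T.H.) (at `ε = 1`): it lies in the layer F₊. -/
theorem not_technicalHypothesis_pair_of_liouvilleOrder_two (t : ℂ) {ρ : ℝ} (hρ : LiouvilleOrder 2 ρ) :
    ¬ TechnicalHypothesis ![t, (ρ : ℂ) * t] := by
  intro hT
  obtain ⟨H₀, hH₀, hTH⟩ := hT 1 one_pos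
  obtain ⟨r, hden, hne, hlt⟩ := hρ (max 3 (max ⌈H₀⌉₊ ⌈‖t‖ + |ρ| + 3⌉₊))
  set q : ℕ := r.den with hq
  set p : ℤ := r.num with hp
  have hq3 : (3 : ℝ) ≤ q := by exact_mod_cast (le_max_left _ _).trans hden
  have hqH : H₀ ≤ q :=
    (Nat.le_ceil H₀).trans (by exact_mod_cast ((le_max_left _ _).trans (le_max_right _ _)).trans hden)
  have hqt : ‖t‖ + |ρ| + 3 ≤ q :=
    (Nat.le_ceil _).trans (by exact_mod_cast ((le_max_right _ _).trans (le_max_right _ _)).trans hden)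
  have hq0 : (0 : ℝ) < q := by linarith
  have hr : (r : ℝ) = (p : ℝ) / q := by rw [hp, hq]; exact Rat.cast_def r
  -- the relation vector `h = (−p, q)`
  set h : Fin 2 → ℤ := ![-p, (q : ℤ)] with hh
  have h0 : h 0 = -p := rfl
  have h1 : h 1 = q := rfl
  have hne0 : h ≠ 0 := by
    intro h0'
    have h1' := congrFun h0' 1
    rw [h1, Pi.zero_apply] at h1'
    have := r.den_pos
    omega
  have hformC : ∑ i, (h i : ℂ) * (![t, (ρ : ℂ) * t] : Fin 2 → ℂ) i =
      t * (((-(p : ℝ) + (q : ℝ) * ρ : ℝ)) : ℂ) := by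
    rw [Fin.sum_univ_two, h0, h1]
    simp only [Matrix.cons_val_zero, Matrix.cons_val_one]
    push_cast
    ring
  have hformR : -(p : ℝ) + (q : ℝ) * ρ = q * (ρ - r) := by
    rw [hr]; field_simp; ring
  have hnorm : ‖∑ i, (h i : ℂ) * (![t, (ρ : ℂ) * t] : Fin 2 → ℂ) i‖ = ‖t‖ * (q * |ρ - r|) := by
    rw [hformC, norm_mul, Complex.norm_real, Real.norm_eq_abs, hformR, abs_mul, abs_of_pos hq0]
  -- heights `≤ (|ρ| + 2) q`
  have he1 : Real.exp (-((q : ℝ) ^ 2)) ≤ 1 := Real.exp_le_one_iff.mpr (by nlinarith)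
  have hr2 : |(r : ℝ)| < |ρ| + 1 := by
    have htri := abs_sub_abs_le_abs_sub (r : ℝ) ρ
    rw [abs_sub_comm] at htri
    linarith
  have hp2 : |(p : ℝ)| < (|ρ| + 1) * q := by
    rw [hr, abs_div, abs_of_pos hq0, div_lt_iff₀ hq0] at hr2
    exact hr2
  set H : ℝ := (|ρ| + 2) * q with hHdef
  have hbound : ∀ i, |((h i : ℤ) : ℝ)| ≤ H := by
    intro i
    fin_cases i
    · show |((h 0 : ℤ) : ℝ)| ≤ H
      rw [h0]; push_cast; rw [abs_neg, hHdef]; nlinarith [abs_nonneg ρ]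
    · show |((h 1 : ℤ) : ℝ)| ≤ H
      rw [h1]; push_cast; rw [Nat.abs_cast, hHdef]; nlinarith [abs_nonneg ρ]
  have hH0 : H₀ ≤ H := by rw [hHdef]; nlinarith [abs_nonneg ρ]
  -- (T.H.) at `ε = 1`
  have hT1 := hTH H hH0 h hne0 hbound
  rw [Real.rpow_one, hnorm] at hT1
  -- `‖t‖ q |ρ − r| < ‖t‖ q e^{−q²} ≤ e^{−H}`
  have hsmall : ‖t‖ * (q * |ρ - r|) ≤ ‖t‖ * (q * Real.exp (-((q : ℝ) ^ 2))) :=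
    mul_le_mul_of_nonneg_left (mul_le_mul_of_nonneg_left hlt.le hq0.le) (norm_nonneg t)
  have hexp : ‖t‖ * (q * Real.exp (-((q : ℝ) ^ 2))) < Real.exp (-H) := by
    have hq' : ‖t‖ * q < (q : ℝ) ^ 2 - H + 1 := by rw [hHdef]; nlinarith [norm_nonneg t, abs_nonneg ρ]
    have he : (q : ℝ) ^ 2 - H + 1 ≤ Real.exp ((q : ℝ) ^ 2 - H) := Real.add_one_le_exp _
    calc ‖t‖ * (q * Real.exp (-((q : ℝ) ^ 2))) = ‖t‖ * q * Real.exp (-((q : ℝ) ^ 2)) := by ring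
      _ < Real.exp ((q : ℝ) ^ 2 - H) * Real.exp (-((q : ℝ) ^ 2)) :=
          mul_lt_mul_of_pos_right (hq'.trans_le he) (Real.exp_pos _)
      _ = Real.exp (-H) := by rw [← Real.exp_add]; ring_nf
  linarith

open Literature.Barriers.Schanuel (TechnicalHypothesis) in
/-- Scope of the positive-order pairs inside item 33364: `LinLiouville`, NOT `HyperLinLiouville` (when the ratio is
not hyper-Liouville), NOT (T.H.) — i.e. members of the layer F₊ (`k ≥ 3` for the Liouville property as typed). -/
theorem posOrderPair_scope {t : ℂ} (ht : t ≠ 0) {ρ : ℝ} {k : ℕ} (hk : 3 ≤ k) (hρ : LiouvilleOrder k ρ)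
    (hnh : ¬ HyperLiouville ρ) :
    LinearIndependent ℚ ![t, (ρ : ℂ) * t] ∧ LinLiouville ![t, (ρ : ℂ) * t] ∧
      ¬ HyperLinLiouville ![t, (ρ : ℂ) * t] ∧ ¬ TechnicalHypothesis ![t, (ρ : ℂ) * t] := by
  have hli := linearIndependent_pair_of_irrational ht (hρ.irrational hk)
  exact ⟨hli, linLiouville_of_liouville_ratio (hρ.liouville hk) t,
    not_hyperLinLiouville_of_ratio_not_hyperLiouville hnh hli,
    not_technicalHypothesis_pair_of_liouvilleOrder_two t (hρ.mono (by omega))⟩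

/-! ### The dark scale `t_Ω` (`Ω e^Ω = 1`) -/

/-- The omega constant exists: `x·e^x = 1` has a root in `(0, 1)`. -/
theorem exists_omegaConst : ∃ x : ℝ, 0 < x ∧ x < 1 ∧ x * Real.exp x = 1 := by
  have hcont : ContinuousOn (fun x : ℝ => x * Real.exp x) (Set.Icc 0 1) :=
    (continuous_id.mul Real.continuous_exp).continuousOn
  have hmem : (1 : ℝ) ∈ Set.Icc ((0 : ℝ) * Real.exp 0) (1 * Real.exp 1) := by
    refine ⟨by simp, ?_⟩
    rw [one_mul]; linarith [Real.add_one_le_exp (1 : ℝ)]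
  obtain ⟨x, ⟨hx0, hx1⟩, hfx⟩ := intermediate_value_Icc zero_le_one hcont hmem
  have hfx' : x * Real.exp x = 1 := hfx
  refine ⟨x, lt_of_le_of_ne hx0 ?_, lt_of_le_of_ne hx1 ?_, hfx'⟩
  · rintro rfl; simp at hfx'
  · rintro rfl
    have : Real.exp 1 = 1 := by rw [one_mul] at hfx'; exact hfx'
    linarith [Real.add_one_le_exp (1 : ℝ)]

/-- `Ω ≈ 0.567`, the omega constant. -/
def omegaConst : ℝ := Classical.choose exists_omegaConst

/-- `0 < Ω`. -/
theorem omegaConst_pos : 0 < omegaConst := (Classical.choose_spec exists_omegaConst).1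
/-- `Ω < 1`. -/
theorem omegaConst_lt_one : omegaConst < 1 := (Classical.choose_spec exists_omegaConst).2.1
/-- `Ω · e^Ω = 1`. -/
theorem omegaConst_mul_exp : omegaConst * Real.exp omegaConst = 1 := (Classical.choose_spec exists_omegaConst).2.2

/-- The dark scale `t_Ω := Ω ∈ ℂ`. -/
def tΩ : ℂ := (omegaConst : ℂ)

/-- `t_Ω ≠ 0`. -/
theorem tΩ_ne_zero : tΩ ≠ 0 := by
  rw [tΩ, Ne, Complex.ofReal_eq_zero]; exact omegaConst_pos.ne'

/-- `e^{t_Ω} = t_Ω⁻¹`: `(t_Ω, e^{t_Ω})` lies on the hyperbola `XY = 1`. -/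
theorem cexp_tΩ : cexp tΩ = tΩ⁻¹ := by
  rw [tΩ, ← Complex.ofReal_exp, ← Complex.ofReal_inv, Complex.ofReal_inj]
  exact eq_inv_of_mul_eq_one_right omegaConst_mul_exp

/-- `t_Ω · e^{t_Ω} = 1` in `ℂ`. -/
theorem tΩ_mul_cexp : tΩ * cexp tΩ = 1 := by
  rw [cexp_tΩ, mul_inv_cancel₀ tΩ_ne_zero]

open Literature.NumberTheory.Transcendental.LindemannWeierstrass (SumForm_holds transcendental_exp_of_sumForm) in
/-- `t_Ω` is transcendental (Hermite–Lindemann, TREE-proved `SumForm_holds`: were `t_Ω` algebraic, `e^{t_Ω} = t_Ω⁻¹`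
would be both transcendental and algebraic). -/
theorem transcendental_tΩ : Transcendental ℚ tΩ := by
  intro halg
  have hT := transcendental_exp_of_sumForm SumForm_holds halg tΩ_ne_zero
  rw [cexp_tΩ] at hT
  exact hT halg.inv

/-- `(t_Ω, e^{t_Ω})` is algebraically DEPENDENT (`XY − 1`): `t_Ω` is an exponential-algebraic («dark») point —
no coordinate of a pair at scale `t_Ω` is decided by the generic cell at that coordinate. -/
theorem not_algebraicIndependent_tΩ : ¬ AlgebraicIndependent ℚ ![tΩ, cexp tΩ] := by
  intro hai
  have h := (algebraicIndependent_iff.mp hai) (MvPolynomial.X 0 * MvPolynomial.X 1 - 1) (by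
    simp [tΩ_mul_cexp])
  have h' := congrArg (MvPolynomial.aeval (![1, 2] : Fin 2 → ℚ)) h
  simp at h'
  norm_num at h'

/-- `e^{t_Ω} = t_Ω⁻¹` is transcendental: `t_Ω` is NOT a logarithm of an algebraic number (no log-cell or Kummer-cell at this scale). -/
theorem transcendental_cexp_tΩ : Transcendental ℚ (cexp tΩ) := by
  rw [cexp_tΩ]
  intro h
  exact transcendental_tΩ (by simpa using h.inv)

/-- `t_Ω` is NOT a fixed point of `exp` (no `RootDecomp1KRadical` fixed-point cell at this scale): `e^{t_Ω} = t_Ω⁻¹ > 1 > t_Ω`. -/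
theorem cexp_tΩ_ne_self : cexp tΩ ≠ tΩ := by
  rw [cexp_tΩ, tΩ, ← Complex.ofReal_inv, Ne, Complex.ofReal_inj]
  intro h
  have h2 : omegaConst⁻¹ * omegaConst = 1 := inv_mul_cancel₀ omegaConst_pos.ne'
  rw [h] at h2
  nlinarith [omegaConst_lt_one, omegaConst_pos, h2]

/-- **`t_Ω` is a DARK scale** (hypothesis-free): transcendental, with transcendental exponential, not a fixed point of `exp`,
and `(t_Ω, e^{t_Ω})` algebraically dependent — so NO tree cell keyed to the scale applies at `t_Ω`: not the anchored /
`W`-cells (algebraic scale), not the log-cell or Kummer-cells (`e^t` algebraic), not the `Radical` fixed-point cells (`e^t = t`),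
not the generic cell at coordinate `0` (independent pair). -/
theorem tΩ_dark : Transcendental ℚ tΩ ∧ Transcendental ℚ (cexp tΩ) ∧ cexp tΩ ≠ tΩ ∧
    ¬ AlgebraicIndependent ℚ ![tΩ, cexp tΩ] :=
  ⟨transcendental_tΩ, transcendental_cexp_tΩ, cexp_tΩ_ne_self, not_algebraicIndependent_tΩ⟩

/-- `t_Ω` carries the log-square measure and the TREE class `LogPowMeasure` (mod NW96 Thm 1) — the first member of the
TREE CLASS `LogPowMeasure` at a dark point (the tree's earlier dark-point measures, at the fixed points of `exp` and at
logarithms of algebraic numbers, live in `RootDecomp1KRadical.FiniteTranscendenceType` and feed hyper-Liouville cells only). -/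
theorem logPowMeasure_tΩ (hNW : NesterenkoWaldschmidt1996_thm_1) : LogPowMeasure (![tΩ] : Fin 1 → ℂ) :=
  logPowMeasure_of_dep hNW transcendental_tΩ not_algebraicIndependent_tΩ

/-! ### Member A: ratio `ℓ_T` (log-hyper-Liouville of exponential order 0) -/

/-- `ℓ_T` has NO exponential order `12` (from the TREE certificate `form_lower_bound` on `(1, ℓ₂, ℓ_T)` with `h₁ = 0`):
in particular it is outside the order-49 cells of `RootDecomp1KGeneric16`. -/
theorem not_liouvilleOrder_twelve_ellT : ¬ LiouvilleOrder 12 ellT := by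
  intro hord
  obtain ⟨r, hden, hne, hlt⟩ := hord (4 ^ 11 + 1)
  set q : ℕ := r.den with hq
  set p : ℤ := r.num with hp
  have hqN : (4 : ℝ) ^ 11 + 1 ≤ q := by exact_mod_cast hden
  have hq0 : (0 : ℝ) < q := by linarith
  have hq1 : (1 : ℝ) ≤ q := by linarith
  have hr : (r : ℝ) = (p : ℝ) / q := by rw [hp, hq]; exact Rat.cast_def r
  -- the form `(−p, 0, q)` in `(1, ℓ₂, ℓ_T)`
  set g : Fin 3 → ℤ := ![-p, 0, (q : ℤ)] with hg
  have hg0 : g ≠ 0 := by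
    intro h0
    have h2 := congrFun h0 2
    have e2 : g 2 = q := rfl
    rw [e2, Pi.zero_apply] at h2
    have := r.den_pos
    omega
  have hlow := form_lower_bound g hg0
  have e0 : ((g 0 : ℤ) : ℝ) = -(p : ℝ) := by show ((![-p, 0, (q : ℤ)] 0 : ℤ) : ℝ) = _; simp
  have e1 : ((g 1 : ℤ) : ℝ) = 0 := by show ((![-p, 0, (q : ℤ)] 1 : ℤ) : ℝ) = _; simp
  have e2 : ((g 2 : ℤ) : ℝ) = q := by show ((![-p, 0, (q : ℤ)] 2 : ℤ) : ℝ) = _; simp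
  have hsum : ∑ i, (|g i| : ℝ) = |(p : ℝ)| + q := by
    rw [Fin.sum_univ_three, e0, e1, e2, abs_neg, abs_zero, Nat.abs_cast]; ring
  rw [hsum, e0, e1, e2, zero_mul, add_zero] at hlow
  -- hlow : exp(−(1 + |p| + q)^11) ≤ |−p + q ℓ_T| = q |ℓ_T − r|
  have hform : -(p : ℝ) + (q : ℝ) * ellT = q * (ellT - r) := by rw [hr]; field_simp; ring
  rw [hform, abs_mul, abs_of_pos hq0] at hlow
  -- `|p| ≤ 2q`
  have hr2 : |(r : ℝ)| < 2 := by
    have htri := abs_sub_abs_le_abs_sub (r : ℝ) ellT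
    rw [abs_sub_comm] at htri
    have h1 : |ellT| ≤ 1 := abs_le.mpr ⟨by linarith [ellT_pos], ellT_lt_one.le⟩
    have h2 : |ellT - r| < 1 :=
      hlt.trans_le (Real.exp_le_one_iff.mpr (neg_nonpos.mpr (pow_nonneg hq0.le 12)))
    linarith
  have hp2 : |(p : ℝ)| ≤ 2 * q := by
    rw [hr, abs_div, abs_of_pos hq0, div_lt_iff₀ hq0] at hr2
    exact hr2.le
  -- compare: `q exp(−q^12) < exp(−(4q)^11) ≤ exp(−(1+|p|+q)^11)`
  have hup : (q : ℝ) * |ellT - r| < q * Real.exp (-((q : ℝ) ^ 12)) := mul_lt_mul_of_pos_left hlt hq0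
  have hmono : Real.exp (-((4 * (q : ℝ)) ^ 11)) ≤ Real.exp (-((1 + (|(p : ℝ)| + q)) ^ 11)) := by
    rw [Real.exp_le_exp, neg_le_neg_iff]
    exact pow_le_pow_left₀ (by positivity) (by linarith) 11
  have hkey : (q : ℝ) * Real.exp (-((q : ℝ) ^ 12)) ≤ Real.exp (-((4 * (q : ℝ)) ^ 11)) := by
    -- `q ≤ exp(q^11)` and `q^12 ≥ (4^11 + 1) q^11`
    have hq11 : (q : ℝ) ≤ Real.exp ((q : ℝ) ^ 11) := by
      have : (q : ℝ) ≤ (q : ℝ) ^ 11 := le_self_pow₀ hq1 (by norm_num)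
      exact this.trans ((by linarith : (q : ℝ) ^ 11 ≤ (q : ℝ) ^ 11 + 1).trans (Real.add_one_le_exp _))
    have hsplit : (q : ℝ) ^ 11 + (4 * (q : ℝ)) ^ 11 ≤ (q : ℝ) ^ 12 := by
      have e : (q : ℝ) ^ 12 = q * (q : ℝ) ^ 11 := by ring
      rw [e, mul_pow]
      nlinarith [pow_nonneg hq0.le 11]
    calc (q : ℝ) * Real.exp (-((q : ℝ) ^ 12))
        ≤ Real.exp ((q : ℝ) ^ 11) * Real.exp (-((q : ℝ) ^ 12)) :=
          mul_le_mul_of_nonneg_right hq11 (Real.exp_pos _).le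
      _ = Real.exp ((q : ℝ) ^ 11 - (q : ℝ) ^ 12) := by rw [← Real.exp_add]; ring_nf
      _ ≤ Real.exp (-((4 * (q : ℝ)) ^ 11)) := by rw [Real.exp_le_exp]; linarith
  linarith

/-- `ℓ_T` has no exponential Liouville order 49 (it is of order 0). -/
theorem not_liouvilleOrder49_ellT : ¬ LiouvilleOrder 49 ellT :=
  fun h => not_liouvilleOrder_twelve_ellT (h.mono (by norm_num))

/-- `ℓ_T` is not hyper-Liouville. -/
theorem not_hyperLiouville_ellT : ¬ HyperLiouville ellT :=
  fun h => not_liouvilleOrder_twelve_ellT (LiouvilleOrder.of_hyperLiouville h 12)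

/-- **Member A**: `z_A = (t_Ω, ℓ_T · t_Ω)`. -/
def zA : Fin 2 → ℂ := ![tΩ, (ellT : ℂ) * tΩ]

/-- `z_A = (t_Ω, ℓ_T·t_Ω)` is ℚ-linearly independent. -/
theorem linearIndependent_zA : LinearIndependent ℚ zA :=
  linearIndependent_pair_of_irrational tΩ_ne_zero logHyperLiouville_ellT.liouville.irrational

/-- `z_A` is linearly Liouville. -/
theorem linLiouville_zA : LinLiouville zA := linLiouville_of_liouville_ratio logHyperLiouville_ellT.liouville tΩ

/-- `z_A` is not hyper-linearly-Liouville. -/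
theorem not_hyperLinLiouville_zA : ¬ HyperLinLiouville zA :=
  not_hyperLinLiouville_of_ratio_not_hyperLiouville not_hyperLiouville_ellT linearIndependent_zA

/-- `z_A` is in the scope of item 33364 (all three binders, hypothesis-free). -/
theorem zA_in_scope_33364 :
    LinearIndependent ℚ zA ∧
    (∀ ω : ℕ, ∃ h : Fin 2 → ℤ, h ≠ 0 ∧ ‖∑ i, (h i : ℂ) * zA i‖ < 1 / (1 + ∑ i, (|h i| : ℝ)) ^ ω) ∧
    ¬ (∀ m : ℕ, ∃ h : Fin 2 → ℤ, h ≠ 0 ∧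
        ‖∑ i, (h i : ℂ) * zA i‖ < Real.exp (-((1 + ∑ i, (|h i| : ℝ)) ^ m))) :=
  ⟨linearIndependent_zA, linLiouville_zA, not_hyperLinLiouville_zA⟩

/-- SEPARATION for `z_A`: the scale is dark (`tΩ_dark`: no anchored, log-, fixed-point or generic cell at coordinate 0), the ratio is neither hyper-Liouville
(no `DarkHyperPair`/weak-class cell) nor of exponential order 49 (no `ordCell`), so `z_A` lies in the residual of
record of VERDICT L1409 (4) — and is decided here. -/
theorem zA_separation :
    (Transcendental ℚ (zA 0) ∧ Transcendental ℚ (cexp (zA 0)) ∧ cexp (zA 0) ≠ zA 0 ∧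
      ¬ AlgebraicIndependent ℚ ![zA 0, cexp (zA 0)]) ∧ ¬ HyperLiouville ellT ∧ ¬ LiouvilleOrder 49 ellT :=
  ⟨tΩ_dark, not_hyperLiouville_ellT, not_liouvilleOrder49_ellT⟩

/-- **Schanuel at `z_A`** (mod NW96 Thm 1). -/
theorem sb_zA (hNW : NesterenkoWaldschmidt1996_thm_1) : SB 2 zA :=
  sb_two_logHyperPair hNW tΩ_ne_zero logHyperLiouville_ellT

/-- Item 33364's text at `z_A`, binders verbatim (mod NW96 Thm 1). -/
theorem finiteOrderLiouvilleSchanuel_at_zA (hNW : NesterenkoWaldschmidt1996_thm_1) :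
    LinearIndependent ℚ zA →
    (∀ ω : ℕ, ∃ h : Fin 2 → ℤ, h ≠ 0 ∧ ‖∑ i, (h i : ℂ) * zA i‖ < 1 / (1 + ∑ i, (|h i| : ℝ)) ^ ω) →
    (¬ ∀ m : ℕ, ∃ h : Fin 2 → ℤ, h ≠ 0 ∧
        ‖∑ i, (h i : ℂ) * zA i‖ < Real.exp (-((1 + ∑ i, (|h i| : ℝ)) ^ m))) →
    ((2 : ℕ) : Cardinal) ≤ Algebra.trdeg ℚ
      ↥(IntermediateField.adjoin ℚ (Set.range zA ∪ Set.range (Complex.exp ∘ zA))) :=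
  fun _ _ _ => sb_zA hNW

/-! ### Member B: ratio `towerNumber 4` (exponential order 3 — the positive-order layer proper) -/

open Summit.Schanuel.Schanuel.Theorems.RootDecomp1KFiniteOrderCell (towerNumber liouvilleOrder_towerNumber
  not_liouvilleOrder_towerNumber not_hyperLiouville_towerNumber towerNumber_pos towerNumber_le_one)

/-- **Member B**: `z_B = (t_Ω, T₄ · t_Ω)`, `T₄ = towerNumber 4 = Σ 2^{−k↑↑…}` of exponential order exactly `3`–`4`. -/
def zB : Fin 2 → ℂ := ![tΩ, (towerNumber 4 : ℂ) * tΩ]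

/-- `towerNumber 4` has exponential Liouville order 3. -/
theorem liouvilleOrder_three_T4 : LiouvilleOrder 3 (towerNumber 4) := liouvilleOrder_towerNumber 3

/-- `towerNumber 4` has no exponential Liouville order 5. -/
theorem not_liouvilleOrder_five_T4 : ¬ LiouvilleOrder 5 (towerNumber 4) := not_liouvilleOrder_towerNumber (by norm_num)

/-- `towerNumber 4` has no exponential Liouville order 49. -/
theorem not_liouvilleOrder49_T4 : ¬ LiouvilleOrder 49 (towerNumber 4) :=
  fun h => not_liouvilleOrder_five_T4 (h.mono (by norm_num))

open Literature.Barriers.Schanuel (TechnicalHypothesis) in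
/-- `z_B` is in the scope of item 33364 AND of the layer F₊ (violates (T.H.)), hypothesis-free. -/
theorem zB_in_scope_posLayer :
    LinearIndependent ℚ zB ∧ LinLiouville zB ∧ ¬ HyperLinLiouville zB ∧ ¬ TechnicalHypothesis zB :=
  posOrderPair_scope tΩ_ne_zero le_rfl liouvilleOrder_three_T4 (not_hyperLiouville_towerNumber (by norm_num))

/-- SEPARATION for `z_B`: dark scale (`tΩ_dark`), ratio of exponential order `3` but NOT `5` (so not 49, not hyper). -/
theorem zB_separation :
    (Transcendental ℚ (zB 0) ∧ Transcendental ℚ (cexp (zB 0)) ∧ cexp (zB 0) ≠ zB 0 ∧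
      ¬ AlgebraicIndependent ℚ ![zB 0, cexp (zB 0)]) ∧ ¬ HyperLiouville (towerNumber 4) ∧
      ¬ LiouvilleOrder 49 (towerNumber 4) ∧ LiouvilleOrder 3 (towerNumber 4) :=
  ⟨tΩ_dark, not_hyperLiouville_towerNumber (by norm_num), not_liouvilleOrder49_T4, liouvilleOrder_three_T4⟩

/-- **Schanuel at `z_B`** (mod NW96 Thm 1). -/
theorem sb_zB (hNW : NesterenkoWaldschmidt1996_thm_1) : SB 2 zB :=
  sb_two_of_posOrderRatio hNW zB_in_scope_posLayer.1 le_rfl (liouvilleOrder_three_T4.mono (by norm_num)) rfl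

/-- Item 33364's text at `z_B`, binders verbatim (mod NW96 Thm 1). -/
theorem finiteOrderLiouvilleSchanuel_at_zB (hNW : NesterenkoWaldschmidt1996_thm_1) :
    LinearIndependent ℚ zB →
    (∀ ω : ℕ, ∃ h : Fin 2 → ℤ, h ≠ 0 ∧ ‖∑ i, (h i : ℂ) * zB i‖ < 1 / (1 + ∑ i, (|h i| : ℝ)) ^ ω) →
    (¬ ∀ m : ℕ, ∃ h : Fin 2 → ℤ, h ≠ 0 ∧
        ‖∑ i, (h i : ℂ) * zB i‖ < Real.exp (-((1 + ∑ i, (|h i| : ℝ)) ^ m))) →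
    ((2 : ℕ) : Cardinal) ≤ Algebra.trdeg ℚ
      ↥(IntermediateField.adjoin ℚ (Set.range zB ∪ Set.range (Complex.exp ∘ zB))) :=
  fun _ _ _ => sb_zB hNW

end Summit.Schanuel.Schanuel.Theorems.RootDecomp1KDarkLogSq

end
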